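import Summits.ResolutionOfSingularities.ResolutionOfSingularities.Theorems.FrobeniusClosingPatchingRelPerfectDepthLegalExit
import HarnessLib

/-!
# Crux `PatchingRelPerfect` (stmt-ResolutionOfSingularities-16161), chain W5.2 — T6-E1b residual `LegalScopedDivisorReduction₃`,
# PHASE 2 closer (2b), spec D5: the EXIT for SEVERAL host components

[OURS · L1 W5.2 · res-L1-w52-lead-1 g5, hand #3b; spec `L/res-L1-w52-lead-1/PHASE2-STEPB-SPEC.md` D5] Replaces the role of NO printed item;
NOT a statement of the manuscript under review; fact-free.

The separation game processes the integral components `X_a = V(D_a)` of the regular host one at a time (spec D1); at the end every `X_a`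
is disjoint from the positive boundary, and the `X_a` are pairwise disjoint regular hypersurfaces. Then the whole family
«hosts ++ boundary» has simple normal crossings — at each point at most ONE host is present, and there only the host (brick B2′'s exchange
`HostState.exists_rsop_eq`), elsewhere only the snc boundary:

* `hasSNC_hosts_append` — `HasSNC (Ds ++ Es)` for pairwise disjoint regular hypersurface hosts `Ds`, an snc family `Es`, hosts disjoint from `Es`;
* `exists_snc_support_hosts` — the `SncSupport` shape for `H = N · monomialIdeal L` whenever `Supp N ⊆ ⋃ Ds` and the positive members of `L`
  together with the hosts are as above.

AI-written; AI review is weaker than expert review.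

## References
* E. Bierstone, D. Grigoriev, P. Milman, J. Włodarczyk, arXiv:1206.3090, Def. 3.1.1. [BierstoneGrigorievMilmanWlodarczyk2011]
* H. Matsumura, *Commutative Ring Theory* (1986), Thm. 14.2. [Matsumura1987]
-/

-- `Summit.<Summit>.<Sub>.Theorems` with `Sub = Summit` (single-conjunct summit, D-0017)
set_option linter.dupNamespace false

noncomputable section

open CategoryTheory CategoryTheory.Limits AlgebraicGeometry TopologicalSpace IsLocalRing
open Literature.AlgebraicGeometry.Resolution Scheme.IdealSheafData

namespace Summit.ResolutionOfSingularities.ResolutionOfSingularities.Theorems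

universe u

namespace DepthLegal

variable {E : Scheme.{u}}

/-- [OURS · L1 W5.2] **Pairwise disjoint regular hypersurfaces ++ an snc family disjoint from them have simple normal crossings.**
[cite: BierstoneGrigorievMilmanWlodarczyk2011, Def. 3.1.1] [cite: Matsumura1987, Thm. 14.2] -/
theorem hasSNC_hosts_append (hE : Scheme.IsRegular E) (Ds Es : List E.IdealSheafData) (hEs : HasSNC Es)
    (hhyp : ∀ D ∈ Ds, ∀ x ∈ D.support, ∃ v : E.presheaf.stalk x,
      stalkIdeal D x = Ideal.span {v} ∧ v ∉ (maximalIdeal (E.presheaf.stalk x)) ^ 2)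
    (hDD : Ds.Pairwise fun D D' => Disjoint (D.support : Set E) D'.support)
    (hDE : ∀ D ∈ Ds, ∀ F ∈ Es, Disjoint (D.support : Set E) F.support) : HasSNC (Ds ++ Es) := by
  classical
  induction Ds with
  | nil => simpa using hEs
  | cons D Ds ih =>
    have hDs : HasSNC (Ds ++ Es) :=
      ih (fun D' hD' => hhyp D' (List.mem_cons_of_mem _ hD')) (List.pairwise_cons.mp hDD).2
        (fun D' hD' => hDE D' (List.mem_cons_of_mem _ hD'))
    -- `D` is disjoint from every member of `Ds ++ Es`
    have hdisj : ∀ G ∈ Ds ++ Es, Disjoint (D.support : Set E) G.support := by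
      intro G hG
      rcases List.mem_append.mp hG with h | h
      · exact (List.pairwise_cons.mp hDD).1 G h
      · exact hDE D List.mem_cons_self G h
    rw [List.cons_append]
    refine hasSNC_of_labels _ fun x => ?_
    haveI : IsRegularLocalRing (E.presheaf.stalk x) := hE x
    by_cases hx : x ∈ D.support
    · -- only `D` passes through `x`
      obtain ⟨v, hDx, hv2⟩ := hhyp D List.mem_cons_self x hx
      have hvm : v ∈ maximalIdeal (E.presheaf.stalk x) :=
        (Ideal.span_singleton_le_iff_mem _).mp (hDx ▸ (mem_support_iff_stalkIdeal_le D x).mp hx)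
      obtain ⟨w, i₀, hw, hwi₀⟩ := HostState.exists_rsop_eq hvm hv2
      have honly : ∀ G : {G : E.IdealSheafData // G ∈ D :: (Ds ++ Es) ∧ x ∈ G.support}, G.1 = D := by
        intro G
        rcases List.mem_cons.mp G.2.1 with h | h
        · exact h
        · exact absurd G.2.2 (Set.disjoint_left.mp (hdisj G.1 h) hx)
      refine ⟨‹_›, _, w, rfl, hw, fun _ => i₀, fun G₁ G₂ _ => Subtype.ext ((honly G₁).trans (honly G₂).symm), fun G => ?_⟩
      rw [honly G, hDx, hwi₀]
    · -- only `Ds ++ Es` passes through `x`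
      obtain ⟨hreg, w, hw, ⟨ι, hι, hιD⟩, -⟩ := hDs x
      have hmem : ∀ G : {G : E.IdealSheafData // G ∈ D :: (Ds ++ Es) ∧ x ∈ G.support}, G.1 ∈ Ds ++ Es := by
        intro G
        rcases List.mem_cons.mp G.2.1 with h | h
        · exact absurd (h ▸ G.2.2) hx
        · exact h
      refine ⟨hreg, _, w, rfl, hw, fun G => ι ⟨G.1, hmem G, G.2.2⟩, fun G₁ G₂ heq => ?_, fun G => hιD ⟨G.1, hmem G, G.2.2⟩⟩
      have e := congrArg Subtype.val (hι heq)
      exact Subtype.ext e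

/-- [OURS · L1 W5.2] **THE EXIT for several host components** (`SncSupport` shape): if `H = N · monomialIdeal L` with `Supp N` inside the union of
pairwise disjoint regular hypersurface hosts `Ds`, each disjoint from every positive-exponent boundary member, the boundary being snc, then
`Supp H` lies in the strict normal crossings divisor `⋃ Ds ∪ ⋃_{c_F ≥ 1} Supp F`. [cite: BierstoneGrigorievMilmanWlodarczyk2011, Def. 3.1.1] -/
theorem exists_snc_support_hosts [IsLocallyNoetherian E] (hE : Scheme.IsRegular E) {H N : E.IdealSheafData}
    {L : List (E.IdealSheafData × ℕ)} (hfac : H = N * monomialIdeal L) (hsnc : HasSNC (boundaryOf L)) (Ds : List E.IdealSheafData)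
    (hN : (N.support : Set E) ⊆ ⋃ D ∈ Ds, (D.support : Set E))
    (hhyp : ∀ D ∈ Ds, ∀ x ∈ D.support, ∃ v : E.presheaf.stalk x,
      stalkIdeal D x = Ideal.span {v} ∧ v ∉ (maximalIdeal (E.presheaf.stalk x)) ^ 2)
    (hDD : Ds.Pairwise fun D D' => Disjoint (D.support : Set E) D'.support)
    (hdisj : ∀ D ∈ Ds, ∀ p ∈ L, 0 < p.2 → Disjoint (D.support : Set E) p.1.support) :
    ∃ B : Set E, IsStrictNormalCrossingsDivisor E B ∧ (H.support : Set E) ⊆ B := by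
  classical
  set Es : List E.IdealSheafData := boundaryOf (L.filter fun p => 0 < p.2) with hEs
  have hEsL : ∀ F ∈ Es, F ∈ boundaryOf L := by
    intro F hF
    obtain ⟨a, ha⟩ := mem_boundaryOf_iff.mp hF
    exact mem_boundaryOf_iff.mpr ⟨a, (List.mem_filter.mp ha).1⟩
  have hDE : ∀ D ∈ Ds, ∀ F ∈ Es, Disjoint (D.support : Set E) F.support := by
    intro D hD F hF
    obtain ⟨a, ha⟩ := mem_boundaryOf_iff.mp hF
    obtain ⟨hmem, hpos⟩ := List.mem_filter.mp ha
    exact hdisj D hD (F, a) hmem (by simpa using hpos)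
  have h := (hasSNC_hosts_append hE Ds Es (hsnc.of_subset hEsL) hhyp hDD hDE).isStrictNormalCrossingsDivisor_biUnion_support
  refine ⟨_, h, fun x hx => ?_⟩
  haveI : IsRegularLocalRing (E.presheaf.stalk x) := hE x
  rw [SetLike.mem_coe, hfac, mem_support_iff_stalkIdeal_le, stalkIdeal_mul, (maximalIdeal.isMaximal _).isPrime.mul_le] at hx
  simp only [Set.mem_iUnion, List.mem_append, exists_prop]
  rcases hx with h1 | h1
  · have hxN : x ∈ (N.support : Set E) := (mem_support_iff_stalkIdeal_le N x).mpr h1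
    obtain ⟨D, hD, hxD⟩ := by simpa only [Set.mem_iUnion, exists_prop] using hN hxN
    exact ⟨D, Or.inl hD, hxD⟩
  · obtain ⟨p, hp, hpos, hxp⟩ := DepthHostLaw.exists_mem_support_of_mem_support_monomialIdeal
      ((mem_support_iff_stalkIdeal_le _ x).mpr h1)
    exact ⟨p.1, Or.inr (mem_boundaryOf_iff.mpr ⟨p.2, List.mem_filter.mpr ⟨hp, by simpa using hpos⟩⟩), hxp⟩

end DepthLegal

end Summit.ResolutionOfSingularities.ResolutionOfSingularities.Theorems

end
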